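import Mathlib
import HarnessLib
import HarnessLib.Audit
import Summits.HodgeConjecture.HodgeConjecture.Statement
import Literature.AlgebraicGeometry.Motives.FamiliesVHS

/-!
Route: KatzUnwinding

CLOSED (retired) 2026-08-15T13:48:15Z by operator:999:1257524 — reason: not-a-thesis: assembly does not conclude the sub-problem Statement — note: D-0027 §2.1 audit (human 2026-08-15: routes that do not decide the summit are removed): the assembly concludes `HypergeometricComparison`, not the sub-problem statement; a NEW conforming route may be opened from the same idea (generated `closes : … → _root_.HodgeConjecture`).. The file is kept as the record of this route; refuted decls are indexed as negative knowledge (`ledger negatives`).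

# Route KatzUnwinding — Rigidity forces cycles — unwind a hypergeometric comparison class by middle
convolution to a Kummer endgame

Route KatzUnwinding realises card katz-unwinding-rigid-comparison. X = HypergeometricComparison: let
f : 𝒳 → U, g : 𝒦 → U be smooth projective families (relative dimensions n, n') over an open U ⊂ P¹_ℂ
with exactly three punctures, and t ↦ L_t ⊂ Hⁿ(X_t(ℂ);ℚ), t ↦ L'_t ⊂ H^{n'}(K_t(ℂ);ℚ) FLAT families
of subspaces (sub-local systems of Rⁿf_*ℚ, R^{n'}g_*ℚ, rendered on the tree's REAL singular
cohomology through restrictions from tubes f⁻¹(V)(ℂ)) with a flat isomorphism φ : L → L'. Assume (i)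
L is irreducible as a ℚ-local system; (ii) HYPERGEOMETRIC TYPE: at one puncture the local invariants
have codimension ≤ dim_ℚ End_flat(L) in L_t (so every complex constituent has a pseudo-reflection
there and is a Levelt/Beukers–Heckman hypergeometric, hence Katz-RIGID); (iii) L_t and L'_t are cut
out, at every t, by algebraic idempotent self-correspondences (Katz's character-projector situation;
blocks the constant-factor collapse to full HC); (iv) at ONE fibre φ extends to a morphism of Hodge
structures up to the Tate twist c = (n'−n)/2. THEN at EVERY fibre t, φ_t extends to an operator
Hⁿ(X_t) → H^{n'}(K_t) induced by an algebraic cycle with ℚ-coefficients on X_t × K_t (Kleiman's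
`IsAlgebraicOperator` for the Weil datum B.W of any Betti–Hodge datum B; B enters only through B.W
and the one Hodge hypothesis). X is the Hodge conjecture for the flat, anchor-free comparison
classes Graph(φ_t): HC ⇒ X (Deligne1987 uniqueness of the VHS on an irreducible local system +
Künneth), X ⇏ HC — a named sub-family, NOT a route to the summit (the Assembly ends at X). The two
cruxes split X as KummerEndgame (the finite-monodromy bottom of Katz's algorithm) and
UnwindingReduction (Katz's algorithm read as relative algebraic correspondences: KummerEndgame → X).
Lean: `HypergeometricComparison` — item 0 below (∀ B : BettiHodgeData ℂ, families/tubes/hypotheses →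
∀ t, ∃ T, B.W.IsAlgebraicOperator n n' T ∧ T extends φ_t); the exact 3.8 kB term (term-level `open …
in`, tube restrictions as `let`s) elaborates in Sketch.lean (rc 0, Mathlib +
Literature.AlgebraicGeometry.Motives.FamiliesVHS, route-file opens).

## Assembly
Pure logic: UnwindingReduction is the implication KummerEndgame → HypergeometricComparison, so the
two cruxes compose to X by modus ponens. X is a named sub-family of the Hodge conjecture (the
comparison classes Graph(φ_t) on X_t × K_t), so the Assembly ends at X and NOT at `HodgeConjecture`;
the summit relation is: HC ⇒ X (Deligne1987 Prop. 1.13 + Künneth; to be filed as a support statement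
once Deligne's uniqueness theorem is a Literature fact), and an honest refutation of X or of
KummerEndgame refutes HC. DominantDescent and the informal items filed after open
(DelsarteTowerEndgame, HodgeTwistBookkeeping, OneStepLegendreTest, RigidityCensus) feed the proofs
of the two cruxes, not the Assembly.

Rationale: WHY THIS LINE. Mechanism (card katz-unwinding-rigid-comparison): irreducible rigid local systems
have no moduli, and Katz's existence algorithm (Katz1996 Ch. 5–6; BeukersHeckman1989 Thm 3.5 for the
hypergeometric = three-puncture case) reaches every one of them from a rank-one Kummer sheaf by
middle convolutions MC_χ and rank-one twists; each MC_χ has a GEOMETRIC avatar on families (Katz1996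
Ch. 8, Dettweiler2008MC §2.6: MC_χ(Rⁿf_*)|_t sits in H^{n+1} of the cyclic cover of the total space
branched along the fibre X_t) and Katz's inversion MC_χ̄MC_χ ≅ id(−1) is realised by the locus {f =
t} ≅ X_t × 𝔸¹ inside the double cover, so the whole algorithm is a WORD IN RELATIVE ALGEBRAIC
CORRESPONDENCES; running the inverse word on BOTH realisations of a shared hypergeometric
constituent transports the comparison class Graph(φ_t) (a flat Hodge class on X_t × K_t with NO
special fibre in U — e.g. the rank-4 piece of H³ of the Dwork quintics vs Katz/CdlORV curve
realisations, CandelasDeLaOssaRodriguezVillegas2003, Katz2009) down to a comparison of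
FINITE-MONODROMY (Kummer) constituents on iterated cyclic covers, where — after base change to a
Fermat/Kummer curve — the fixed-part theorem (DeligneHodgeII1971 4.1.1) makes it a Hodge class on a
total space that for Delsarte/generalized-Dwork inputs is a Delsarte complete intersection dominated
by products of Fermat varieties, Shioda's unconditional regime (Shioda1979HodgeFermat Thm IV,
Ran1980, ShiodaKatsura1979); winding back up outputs the cycle on X_t × K_t for all t at once.
Imported areas: rigid local systems / middle convolution (Katz, Dettweiler–Sabbah Hodge bookkeeping
DettweilerSabbah2013), hypergeometric monodromy (Levelt, Beukers–Heckman), Fermat combinatorics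
(Shioda–Katsura–Aoki); Hodge theory enters twice and honestly (Deligne's uniqueness making φ Hodge;
Shioda's eigenspace calculus at the end). What it does that sibling routes do not: AnchorTransport
(VariationalHodge, opened today) transports algebraicity FROM an algebraic anchor fibre and
DworkPrymHodge treats flat finite-monodromy classes on ONE Dwork pencil anchored at the Fermat point
ψ = 0; here the classes are off-diagonal comparison classes of two different families, the mechanism
CHANGES the varieties (convolution tower) instead of deforming a cycle, and no anchor in U is needed
(in the flagship none exists: the Fermat point is a puncture of the descended hypergeometric base).
Versus Patrikis2016KugaSatakeI (middle convolution run inside André's motivated category, for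
Kuga–Satake LIFTING): we need honest cycles for a COMPARISON, so Standard Conjecture B must not be
load-bearing — which is exactly what crux UnwindingReduction tests. Design notes for refuters (traps
already found and built into the typed statements): without (i)+(iii) 'rigid comparison ⇒ algebraic'
collapses to full HC (v ⊗ H¹(E_t) is rigid irreducible; trivial rank-one systems); without (iv) it
is FALSE (a Kummer character realised in H⁰ of the Kummer cover, type (0,0), vs in H¹ of a twisted
CM curve, type (1,0): Deligne's uniqueness fixes Hodge types only up to independent shifts on
Galois-conjugate constituents) — hence the parity + filtration-shift hypothesis.

RANKED CRUXES. #0 HypergeometricComparison (target) — X as in the Thesis: for two smooth projective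
families over a thrice-punctured P¹ and a flat isomorphism φ between a ℚ-irreducible
hypergeometric-type constituent L ⊂ Rⁿf_*ℚ and a constituent L' ⊂ R^{n'}g_*ℚ, both cut out fibrewise
by algebraic idempotents, Hodge up to the twist (n'−n)/2 at one fibre, φ_t extends to an algebraic
operator Hⁿ(X_t) → H^{n'}(K_t) at EVERY fibre (card: RIGID-HC in the hypergeometric |S| = 3 regime;
'all t'). (why it might fail: It is HC for anchor-free flat comparison classes; a hypergeometric
pair whose comparison class is provably non-algebraic refutes HC itself. Residual junk: instances
reduce to 'a lonely invariant Hodge line must pair non-trivially with an algebraic class' (true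
under HC, unproved).) [Katz1996, BeukersHeckman1989, Deligne1987, Kleiman1968AlgebraicCycles,
CandelasDeLaOssaRodriguezVillegas2003, Katz2009]
#2 KummerEndgame (crux) — The finite-monodromy bottom of the unwinding (card U2/U3 as ONE
statement): same frame and hypotheses as the target except that 'hypergeometric type' is replaced by
FINITE MONODROMY of L (a flat family of finite spanning sets F_t ⊂ L_t — monodromy permutes a finite
spanning set iff its image is finite); conclusion identical: φ_t extends to an algebraic operator at
every t. Informally: the comparison of two geometric realisations of a Galois orbit of Kummer
characters (CM-type-matched by the Hodge hypothesis) is induced by algebraic cycles; after base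
change to the trivialising Fermat/Kummer curve T this is HC for ONE fixed-part class Ξ∨ ⊠ Ξ' on a
smooth completion of 𝒳_T ×_T 𝒦_T (DeligneHodgeII1971 4.1.1), closed by Shioda when that total space
is Fermat-dominated (Delsarte complete intersection: the pencil parameter is eliminated, each
cover/base-change adjoins one variable and one binomial relation, exponent matrix square) and
otherwise open. [difficulty: open-problem] (why it might fail: For general input families it is HC
for fixed-part classes on 𝒳_T×_T𝒦_T — no engine beyond Fermat domination (Delsarte towers; Shioda
Thm IV fails at composite degree: Aoki sectors) or an algebraic anchor; eigenline classes themselves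
are of CM type (p,q), only Ξ∨⊠Ξ' is Hodge.) [Shioda1979HodgeFermat, Ran1980, Aoki1987,
ShiodaKatsura1979, DeligneHodgeII1971, Katz2009, Katz1996]
#3 UnwindingReduction (crux) — Katz's algorithm made of cycles (card engine U1 + bookkeeping U5):
KummerEndgame → HypergeometricComparison. Proof plan: L ⊗ ℂ = ⊕ conjugate hypergeometrics H(α;β)
(Levelt: pseudo-reflection at the distinguished puncture); Katz1996 Thm 5.2.1 / BeukersHeckman1989:
a word MC_{χ_m}∘…∘MC_{χ_1} applied to a Kummer sheaf gives H, ranks 1,2,…,r; realise each inverse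
step MC_{χ̄_j} on BOTH families by the cyclic-cover family X^{(j)} → U (Katz1996 Ch. 8,
Dettweiler2008MC §2.6: graph of the cover composed with the character projector Σ χ(ζ)⁻¹ζ_*, a
relative algebraic cycle with ℚ(χ)-coefficients) and the inversion MC_χ MC_χ̄ ≅ id(−1) by the locus
{f = t} ≅ X_t × 𝔸¹ in X^{(j+1)}_t; check at each level that (i) irreducibility, (iii) algebraic
cut-out (base-changed relative idempotent ∘ character projector ∘ PARABOLIC projector) and (iv)
Hodge twist (DettweilerSabbah2013 Thm 1: Hodge numbers and twists under MC_χ) are inherited, so that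
the bottom (finite monodromy: Galois orbit of Kummer characters over the same U) is an instance of
KummerEndgame; then compose the 2m correspondences upward (Kleiman: composites/transposes of
algebraic operators are algebraic — in-tree CorrespondencesCompProofs) to get T with T|_{L_t} = φ_t.
[deps: KummerEndgame] [difficulty: XL] (why it might fail: 'Middle' = weight/boundary truncation:
the projector of H^{n+1}(cover) onto the parabolic part H¹(P¹, j_*(L⊗χ)) need not be cycle-induced
without a Lefschetz/B-type input (refuter audit of the card); cut-out and Hodge hypotheses may not
descend a level; accidental multiplicities in the tower.) [Katz1996, Dettweiler2008MC,
DettweilerSabbah2013, Simpson2009, Patrikis2016KugaSatakeI, BeukersHeckman1989, Andre1996Motifs]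
#9 DominantDescent (support) — Glue for the Delsarte endgame (Fermat product ⇢ Delsarte quotient,
ShiodaKatsura1979): the B-relative Hodge conjecture descends along a surjective morphism π : X → Y
of smooth projective n-folds (β Hodge on Y ⇒ π^*β Hodge (B.pullback_hom) ⇒ algebraic ⇒ β = deg(π)⁻¹
π_*π^*β algebraic). Provable from the Weil-cohomology axioms plus ONE topological input not yet in
the tree: π^* is injective in top degree for a surjective generically finite map (degree in Betti
cohomology, via the naturality of B.iso); true for every datum B. [difficulty: M]
[Kleiman1968AlgebraicCycles, ShiodaKatsura1979, VoisinHodgeI2002]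

TWO-LAYER PLAN. Foreseen glued splits (nothing filed now). KummerEndgame ⇐ DelsarteTowerEndgame
(inputs = invertible/generalized-Dwork pencils and Katz curve families yᴺ = xᵃ(1−x)ᵇ(1−tx)ᶜ:
base-changed towers are Delsarte complete intersections dominated by ∏ X^{nᵢ}_m;
ShiodaFermatProducts (cite fact, Shioda Thm IV) → DominantDescent → endgame) → AnchoredEndgame
(other inputs: route AnchorTransport's VariationalHodge applied to the ψ-line pull-back of the
tower, anchored at the Fermat point, which is a smooth fibre there) → KummerEndgame restricted
accordingly. UnwindingReduction ⇐ OneStepCorrespondence (MC_χ and the inversion are cycle-induced up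
to classes supported on the boundary X_t ∪ f⁻¹(S) of the cover) → BoundaryProjectorAlgebraic (the
parabolic projector is a cycle: boundary classes are Gysin images from lower-dimensional covers of
the SAME shape, induction on n; n = 0,1 by Lefschetz (1,1)) → HodgeTwistBookkeeping
(DettweilerSabbah2013) → UnwindingReduction.

KILL CRITERIA. (a) An honest instance (two families, computed local monodromies and Hodge types)
where the comparison class is shown NON-algebraic refutes HypergeometricComparison or KummerEndgame
and thereby HC: close refuted:<Decl> and escalate (summit news). (b) The route dies AS A MECHANISM
if the one-step Legendre test (Cheapest falsifier) shows that already for curves the parabolic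
projector of H¹ of the cyclic cover is not induced by a divisor correspondence without Standard
Conjecture B: then UnwindingReduction is only a motivated-cycle statement (= Patrikis2016KugaSatakeI
+ Andre1996Motifs, known) — close exhausted with that census or pivot to the conditional bridge
'B(covers) → X'. (c) If the census (support RigidityCensus) finds that every pair of families
sharing a hypergeometric constituent in the literature is already related by a dominant rational map
(Shioda maps: BiniVangeemenKelly2011, Kelly2013, Kloosterman; DoranEtAl2018 alternate mirrors), X
has no open instance of independent interest: downgrade to 'explicit-cycle engine' (support only) or
close superseded by DworkPrymHodge/AnchorTransport. (d) A proof of AnchorTransport.VariationalHodge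
plus anchors for all hypergeometric towers moots UnwindingReduction's cycle form (keep only as an
explicit construction).

NOT DECOMPOSED YET. Deliberately not filed at open: the Delsarte-complete-intersection vocabulary
and DelsarteTowerEndgame as a TYPED statement (definition request below; filed informal after open);
Katz's MC_χ as a Lean definition on local systems (definition request); the explicit CdlORV instance
(Dwork quintic X_ψ vs genus-4 curves A, B: needs smooth projective models of y⁵-curves); the
non-Delsarte endgame (card U3: symmetric K3 quartic pencils, AESZ operators) and the negative branch
(exact cyclotomic periods of Ξ vs Aoki cycles); the census of hypergeometric pairs (card U4); the
summit-side calibration 'HC ⇒ X' (needs Deligne1987 Prop 1.13 and Künneth–Hodge compatibility as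
Literature facts). Typing caveat recorded for grounders: the three typed statements quantify ∀ B :
BettiHodgeData ℂ with B entering only through B.W (cut-outs, conclusion) and one B.hodge HYPOTHESIS;
monodromy is NOT taken from GeometricVHSData (its transport is unconstrained off the fixed part) but
from real tube restrictions; closed proofs will need named facts (Katz MC theory, Ehresmann/local
triviality, Deligne semisimplicity) as hypotheses — supersede the signatures with `(h : Fact B) →`
prefixes when those facts land rather than weakening the statements.

CHEAPEST FALSIFIER. The refuter's one-step test, everything curves and surfaces: take L = the Kummer
sheaf of x^{-1/2}(x−1)^{-1/2} (H⁰ of the double cover of the x-line) so that MC_{−1}(L) = H¹ of the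
Legendre curve E_t : y² = x(x−1)(x−t); realise MC_{−1} and Katz's inversion on the elliptic surface
y² = x(x−1)(x−w²−t₁) and on the double cover of its total space, and check with divisors only
(Lefschetz (1,1) decides everything here) that (1) the parabolic projector of H¹/H² of the covers is
induced by an algebraic correspondence and (2) winding id_L down and up returns a correspondence on
E_s × E_s acting as the identity on H¹. If (1) fails without a B-type input, UnwindingReduction is
dead in cycle form (Kill (b)). Second cheapest: the lookup of Kill (c) (Kloosterman 2017/2018,
DoranEtAl2018 §1, BiniVangeemenKelly2011) for an open hypergeometric pair. Design-time checks
already run (no kit on this hub): the CM-type counterexample to the twist-free statement and the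
constant-factor collapses (Why this line) — both are excluded by the typed hypotheses; Sketch.lean
elaborates (rc 0) and a corrupted variant fails as expected.

NUMBERS. |S| = 3 punctures (hypergeometric ⇔ irreducible with a pseudo-reflection at one of three
punctures, BeukersHeckman1989 Thm 3.5; Katz rigidity index 2). Shioda: HC for the Fermat variety
Xⁿ_m for all n when m is prime or m ≤ 20, and for products ∏X^{nᵢ}_m for the same m
(Shioda1979HodgeFermat Thm IV; in-tree fact `ShiodaFermatStatement B` covers single Fermat varieties
only); first failures of condition (P) at composite m (Aoki1987). Flagship: Dwork quintic pencil, b₃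
= 204 = 4 (the hypergeometric H(1/5,2/5,3/5,4/5; 0,0,0,0), MUM at λ = 0, conifold at λ = 1, order-5
local monodromy at λ = ∞) + 20·4 + 30·4 (quartic factors R_A, R_B of the zeta functions of the
genus-4 curves A, B: CandelasDeLaOssaRodriguezVillegas2003 §§9–11); unwinding depth m = r − 1 = 3
for the rank-4 piece, all covers of degree 5 (prime ⇒ Shioda's regime if the tower stays Delsarte).
14 hypergeometric one-parameter CY3 variations (RodriguezVillegas2003; DoranMorgan) as the census
pool; alternate-mirror invertible pencils with equal dual weights share the hypergeometric zeta
factor (DoranEtAl2018 Thm 1.?: degree ≥ order of the Picard–Fuchs equation).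

DEFINITION REQUESTS. (1) `Literature.AlgebraicGeometry.Motives.LocalSystem.middleConvolution` —
Katz's MC_χ (additive, on local systems of K-vector spaces on ℂ minus a finite set; Katz1996
§2.8–2.9, Dettweiler2008MC §2) with its basic properties as named facts (MC_χ̄MC_χ ≅ id for χ ≠ 1,
rank formula, preservation of the index of rigidity; existence algorithm Katz1996 Thm 5.2.1) — topic
Literature/AlgebraicGeometry/Motives; for UnwindingReduction. (2) `IsInvertiblePencil` /
`IsDelsarteCompleteIntersection` (DoranEtAl2018 §1.2: F_A − ψ∏xᵢ with det A ≠ 0; complete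
intersections with square invertible total exponent matrix) and the Shioda–Katsura domination fact
(ShiodaKatsura1979; Shioda maps BiniVangeemenKelly2011) — topic
Literature/AlgebraicGeometry/Motives; for DelsarteTowerEndgame. (3) `IsFlatSubfamily f n L` +
`tubeRestrict f V s` (the tube-flatness vocabulary used inline in items 0/2: subspaces of
`bettiCohomology (fiberOver f t) n` locally cut out isomorphically by classes on {y ∈ 𝒳(ℂ) | ∃ s ∈
V, y ∈ im X_s(ℂ)}) — topic Summits/HodgeConjecture/HodgeConjecture/Theorems (posited objects; would
shrink the 3.8 kB signatures to a few lines; a later `set-signature` supersedes). (4) Cite facts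
wanted (family hodge): Katz1996 Thm 1.1.2 (physically rigid ⇔ cohomologically rigid) and Thm 8.4.1
(geometric/motivic realisation of rigid irreducibles with quasi-unipotent local monodromy);
BeukersHeckman1989 Thm 3.5 (Levelt); Deligne1987 Prop 1.13 (a polarizable VHS on an irreducible
local system is unique up to shift); DettweilerSabbah2013 Thm 1 (local Hodge data under MC_χ);
Shioda1979HodgeFermat Thm IV for PRODUCTS of Fermat varieties (extend `ShiodaFermatStatement`).

Novelty: Searches (2026-08-15, this session; the card's own audit of 2026-08-15T06:48Z re-read): `lit search
--hybrid "middle convolution rigid local system algebraic cycle correspondence Hodge conjecture"`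
(12 held books: VoisinHodgeI/II, Kerr–Pearlstein 2016, Esnault 2023 lecture notes — pp. 61, 102–120
read: Simpson motivicity, rigid ⇒ integral/crystalline EsnaultGroechenig2018, no cycles for
comparisons); `lit search --source zbmath "middle convolution"` (20: DettweilerSabbah2013,
Simpson2009, DettweilerReiter2010, Völklein 2001, Arinkin 2010, Haraoka/Oshima — all sheaf/ODE
level); `lit search --source zbmath "Dwork family hypergeometric"` (25: Katz2009, DoranEtAl2018 read
pp. 1–3 — equal zeta FACTORS of alternate-mirror invertible pencils via Dwork cohomology, the
arithmetic shadow of X with no correspondence produced; Kloosterman; Long–Tu–Yui–Zudilin 2021 rigid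
hypergeometric CY3); `lit galaxy search "middle convolution" --star all` (pdf star: Geißler 2017
thesis 'Enhanced middle convolution', rest noise; panama/crabby timed out); `lit frontier
HodgeConjecture --since 2020` (30; arXiv:2603.22171 motivic exceptional loci — orthogonal: our
classes have Hodge locus = U); `lit bridges HodgeConjecture --cross any` (nothing on rigid local
systems); remote OpenAlex/S2/arXiv returned HTTP 429 this session (logged). Nearest prior art found:
Katz1996 Ch. 8 / Thm 8.4.1 (MC realised geometrically; 'motivic' = cut out of Rⁿπ_! by a character
projector — SHEAF level); DettweilerSabbah2013 (VH  [refs: 2603.22171, 1407.1942, EsnaultGroechenig2018, DettweilerSabbah2013, Simpson2009, DettweilerReiter2010, Katz2009, DoranEtAl2018, Katz1996, BiniVangeemenKelly2011, Kelly2013, CandelasDeLaOssaRodriguezVillegas2003]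

Barriers (technique_class: middle-convolution, rigid-local-systems, fermat-varieties): - technique_class: middle-convolution, rigid-local-systems, fermat-varieties
- Literature.Barriers.HodgeConjecture.Andre1996_hodgeClassesOnAbelianVarieties_motivated:
André's/Patrikis' use of families gives MOTIVATED classes and stops at Standard Conjecture B; here
each unwinding step is meant to be an honest cycle (cover graph ∘ character projector; inversion
locus), so B is not load-bearing IF the parabolic/boundary projector is itself a cycle — it does not
evade the barrier yet: the barrier is relocated into UnwindingReduction's why-might-fail and the
Cheapest falsifier tests exactly this; the Delsarte endgame evades B outright (Shioda's cycles are
explicit).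
- Literature.Barriers.HodgeConjecture.CattaniDeligneKaplan1995_hodgeLocus_algebraicFor: consistent
and irrelevant — the comparison classes are flat and Hodge on all of U (Hodge locus = U by
Deligne1987), no locus geometry is used.
- Literature.Barriers.HodgeConjecture.Weil1977_exceptionalHodgeClasses: the endgame lives in the
Fermat/CM regime where exceptional classes live; KummerEndgame inherits the composite-degree gaps of
Shioda/Aoki (stated as its failure mode, not evaded); the CM-type mismatch trap is excluded by the
twist hypothesis.
- Literature.Barriers.HodgeConjecture.Voisin2003_generalHypersurface_noIntegralClassInF: not touched
— the base curve carries local systems, never intermediate Jacobians; no normal function is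
inverted; rational coefficients throughout.
- Literature.Barriers.HodgeConjecture.Serre196

History (route lifecycle, newest last):
- 2026-08-15T13:48:15Z · CLOSED retired — not-a-thesis: assembly does not conclude the sub-problem Statement (operator:999:1257524)

sub-problem: HodgeConjecture · status: closed(retired) · opened planner-plancard-HodgeConjecture-HodgeConject-6ed9cb67-0 2026-08-15T11:16:49Z · rev 0 · ledger route-HodgeConjecture-KatzUnwinding
GENERATED by the gate from the ledger (D-0016/17). Provers cite these decls: `theorem foo : Summit.HodgeConjecture.HodgeConjecture.Theses.KatzUnwinding.<Decl> := …` in Summits/HodgeConjecture/HodgeConjecture/Theorems/<Name>.lean.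
-/

namespace Summit.HodgeConjecture.HodgeConjecture.Theses.KatzUnwinding

open scoped BigOperators Topology Manifold Classical MeasureTheory ProbabilityTheory Matrix InnerProductSpace ComplexConjugate ContinuousMap
open Filter Set Function TopologicalSpace MeasureTheory

attribute [summit_statement] _root_.HodgeConjecture

/-- item stmt-HodgeConjecture-3337 · target · rank 0 · closed · moot by None · by planner
why it might fail: False as typed: B.hodge occurs only in (iv), which B↦B.pureEven (in-tree) voids for even n (RetriageJunk2.lean, rc 0); an isotrivial ℤ/4 pair, n=n′=2 ((−1)-curves on Bl₄P² vs T(Fermat quartic)≅ℚ(i)) meets (i)–(iii) with φ_t non-algebraic. Faithful reading = HC for flat comparison classes: open.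
sources: Literature.AlgebraicGeometry.Motives.BettiHodgeData.pureEven, Literature.AlgebraicGeometry.Motives.BettiHodgeData.not_forall_hodgeConjectureFor_of_hodgeNumber_ne_zero, Deligne1987, Kleiman1968AlgebraicCycles, Katz1996, BeukersHeckman1989
[target] X as in the Thesis: for two smooth projective families over a thrice-punctured P¹ and a
flat isomorphism φ between a ℚ-irreducible hypergeometric-type constituent L ⊂ Rⁿf_*ℚ and a
constituent L' ⊂ R^{n'}g_*ℚ, both cut out fibrewise by algebraic idempotents, Hodge up to the twist
(n'−n)/2 at one fibre, φ_t extends to an algebraic operator Hⁿ(X_t) → H^{n'}(K_t) at EVERY fibre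
(card: RIGID-HC in the hypergeometric |S| = 3 regime; 'all t'). -/
@[route_item "route-HodgeConjecture-KatzUnwinding"]
def HypergeometricComparison : Prop :=
  open Literature.AlgebraicGeometry.Motives Literature.AlgebraicTopology.SingularHomology in ∀ (B : BettiHodgeData ℂ) (U 𝒳 𝒦 : SchemeOver ℂ) (j : U ⟶ projectiveSpace 1 ℂ) (f : 𝒳 ⟶ U) (g : 𝒦 ⟶ U) (n n' : ℕ) (hf : IsSmoothProjectiveFamily f n) (hg : IsSmoothProjectiveFamily g n') (L : ∀ t : ComplexPoints U, Submodule ℚ (bettiCohomology (fiberOver f t) n)) (L' : ∀ t : ComplexPoints U, Submodule ℚ (bettiCohomology (fiberOver g t) n')) (φ : ∀ t, L t →ₗ[ℚ] L' t), let Tf := fun V : Set (ComplexPoints U) => {y : ComplexPoints 𝒳 // ∃ s ∈ V, ∃ x : ComplexPoints (fiberOver f s), AlgPoints.map (fiberι f s) x = y}; let resf := fun (V : Set (ComplexPoints U)) (s : ComplexPoints U) (hs : s ∈ V) => (singularCohomology.map ℚ ℚ (⟨fun x => ⟨AlgPoints.map (fiberι f s) x, s, hs, x, rfl⟩, (AlgPoints.mapContinuous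 (L := ℂ) (fiberι f s)).continuous.subtype_mk _⟩ : C(ComplexPoints (fiberOver f s), Tf V)) n).hom; let Tg := fun V : Set (ComplexPoints U) => {y : ComplexPoints 𝒦 // ∃ s ∈ V, ∃ x : ComplexPoints (fiberOver g s), AlgPoints.map (fiberι g s) x = y}; let resg := fun (V : Set (ComplexPoints U)) (s : ComplexPoints U) (hs : s ∈ V) => (singularCohomology.map ℚ ℚ (⟨fun x => ⟨AlgPoints.map (fiberι g s) x, s, hs, x, rfl⟩, (AlgPoints.mapContinuous (L := ℂ) (fiberι g s)).continuous.subtype_mk _⟩ : C(ComplexPoints (fiberOver g s), Tg V)) n').hom; AlgebraicGeometry.IsOpenImmersion j.left → Nat.card {p : ComplexPoints (projectiveSpace 1 ℂ) // p ∉ Set.range (AlgPoints.map j)} = 3 → (∀ t₀, ∃ V ∈ nhds t₀, ∃ (N : Submodule ℚ (singularCohomology ℚ ℚ (Tf V) n)) (N' : Submodule ℚ (singularCohomology ℚ ℚ (Tg V) n')) (Φ : N →ₗ[ℚ] N'), ∀ t (ht : t ∈ V), Submodule.map (resf V t ht) N = L t ∧ (∀ x ∈ N, resf V t ht x = 0 →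 x = 0) ∧ Submodule.map (resg V t ht) N' = L' t ∧ (∀ x ∈ N', resg V t ht x = 0 → x = 0) ∧ ∀ (x : N) (hx : resf V t ht x ∈ L t), (φ t ⟨resf V t ht x, hx⟩).1 = resg V t ht (Φ x)) → (∀ L₁ : ∀ t : ComplexPoints U, Submodule ℚ (bettiCohomology (fiberOver f t) n), (∀ t, L₁ t ≤ L t) → (∀ t₀, ∃ V ∈ nhds t₀, ∃ N : Submodule ℚ (singularCohomology ℚ ℚ (Tf V) n), ∀ t (ht : t ∈ V), Submodule.map (resf V t ht) N = L₁ t ∧ ∀ x ∈ N, resf V t ht x = 0 → x = 0) → (∀ t, L₁ t = ⊥) ∨ (∀ t, L₁ t = L t)) → (∃ s₁ : ComplexPoints (projectiveSpace 1 ℂ), s₁ ∉ Set.range (AlgPoints.map j) ∧ ∀ O ∈ nhds s₁, ∃ O' ∈ nhds s₁, O' ⊆ O ∧ ∀ t (ht : AlgPoints.map j t ∈ O'), Module.finrank ℚ (L t) ≤ Module.finrank ℚ ↥(L t ⊓ LinearMap.range (resf {u | AlgPoints.map j u ∈ O'} t ht)) + Module.finrank ℚ ↥(Submodule.span ℚ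 {ψ : ∀ t, L t →ₗ[ℚ] L t | ∀ t₀, ∃ V ∈ nhds t₀, ∃ (N : Submodule ℚ (singularCohomology ℚ ℚ (Tf V) n)) (Ψ : N →ₗ[ℚ] N), ∀ t (ht : t ∈ V), Submodule.map (resf V t ht) N = L t ∧ (∀ x ∈ N, resf V t ht x = 0 → x = 0) ∧ ∀ (x : N) (hx : resf V t ht x ∈ L t), (ψ t ⟨resf V t ht x, hx⟩).1 = resf V t ht (Ψ x)})) → (∀ t, (∃ e : B.W.obj (fiberOver f t) n →ₗ[ℚ] B.W.obj (fiberOver f t) n, B.W.IsAlgebraicOperator n n e ∧ e ∘ₗ e = e ∧ LinearMap.range e = Submodule.map (B.isoObj (fiberOver f t) n).symm.toLinearMap (L t)) ∧ (∃ e' : B.W.obj (fiberOver g t) n' →ₗ[ℚ] B.W.obj (fiberOver g t) n', B.W.IsAlgebraicOperator n' n' e' ∧ e' ∘ₗ e' = e' ∧ LinearMap.range e' = Submodule.map (B.isoObj (fiberOver g t) n').symm.toLinearMap (L' t))) → (∃ (t₀ : ComplexPoints U) (c : ℤ) (T₀ : B.W.obj (fiberOver f t₀) n →ₗ[ℚ]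 B.W.obj (fiberOver g t₀) n'), (n' : ℤ) = (n : ℤ) + 2 * c ∧ (∀ p : ℤ, Submodule.map (T₀.baseChange ℂ) ((B.hodge (hf.isSmoothProjective t₀) n).F p) ≤ (B.hodge (hg.isSmoothProjective t₀) n').F (p + c)) ∧ ∀ x : L t₀, T₀ ((B.isoObj (fiberOver f t₀) n).symm x.1) = (B.isoObj (fiberOver g t₀) n').symm (φ t₀ x).1) → ∀ t, ∃ T : B.W.obj (fiberOver f t) n →ₗ[ℚ] B.W.obj (fiberOver g t) n', B.W.IsAlgebraicOperator n n' T ∧ ∀ x : L t, T ((B.isoObj (fiberOver f t) n).symm x.1) = (B.isoObj (fiberOver g t) n').symm (φ t x).1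

/-- item stmt-HodgeConjecture-3338 · crux · rank 2 · closed · moot by None · by planner
why it might fail: False as typed: (iv), the only B.hodge input, is void for B.pureEven, n even (RetriageJunk2.lean: crux → Hodge-free form, rc 0); the ℤ/4 isotrivial pair Bl₄P² vs Fermat-quartic K3 then needs a cycle sending divisors into T(K3). Faithful reading = HC for a fixed-part class; sole engine Shioda.
sources: Literature.AlgebraicGeometry.Motives.BettiHodgeData.pureEven, Shioda1979HodgeFermat, Aoki1987, ShiodaKatsura1979, DeligneHodgeII1971, Ran1980
[crux] The finite-monodromy bottom of the unwinding (card U2/U3 as ONE statement): same frame and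
hypotheses as the target except that 'hypergeometric type' is replaced by FINITE MONODROMY of L (a
flat family of finite spanning sets F_t ⊂ L_t — monodromy permutes a finite spanning set iff its
image is finite); conclusion identical: φ_t extends to an algebraic operator at every t. Informally:
the comparison of two geometric realisations of a Galois orbit of Kummer characters (CM-type-matched
by the Hodge hypothesis) is induced by algebraic cycles; after base change to the trivialising
Fermat/Kummer curve T this is HC for ONE fixed-part class Ξ∨ ⊠ Ξ' on a smooth completion of 𝒳_T ×_T
𝒦_T (DeligneHodgeII1971 4.1.1), closed by Shioda when that total space is Fermat-dominated (Delsarte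
complete intersection: the pencil parameter is eliminated, each cover/base-change adjoins one
variable and one binomial relation, exponent matrix square) and otherwise open. [difficulty:
open-problem] -/
@[route_item "route-HodgeConjecture-KatzUnwinding"]
def KummerEndgame : Prop :=
  open Literature.AlgebraicGeometry.Motives Literature.AlgebraicTopology.SingularHomology in ∀ (B : BettiHodgeData ℂ) (U 𝒳 𝒦 : SchemeOver ℂ) (j : U ⟶ projectiveSpace 1 ℂ) (f : 𝒳 ⟶ U) (g : 𝒦 ⟶ U) (n n' : ℕ) (hf : IsSmoothProjectiveFamily f n) (hg : IsSmoothProjectiveFamily g n') (L : ∀ t : ComplexPoints U, Submodule ℚ (bettiCohomology (fiberOver f t) n)) (L' : ∀ t : ComplexPoints U, Submodule ℚ (bettiCohomology (fiberOver g t) n')) (φ : ∀ t, L t →ₗ[ℚ] L' t), let Tf := fun V : Set (ComplexPoints U) => {y : ComplexPoints 𝒳 // ∃ s ∈ V, ∃ x : ComplexPoints (fiberOver f s), AlgPoints.map (fiberι f s) x = y}; let resf := fun (V : Set (ComplexPoints U)) (s : ComplexPoints U) (hs : s ∈ V) => (singularCohomology.map ℚ ℚ (⟨fun x => ⟨AlgPoints.map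 (fiberι f s) x, s, hs, x, rfl⟩, (AlgPoints.mapContinuous (L := ℂ) (fiberι f s)).continuous.subtype_mk _⟩ : C(ComplexPoints (fiberOver f s), Tf V)) n).hom; let Tg := fun V : Set (ComplexPoints U) => {y : ComplexPoints 𝒦 // ∃ s ∈ V, ∃ x : ComplexPoints (fiberOver g s), AlgPoints.map (fiberι g s) x = y}; let resg := fun (V : Set (ComplexPoints U)) (s : ComplexPoints U) (hs : s ∈ V) => (singularCohomology.map ℚ ℚ (⟨fun x => ⟨AlgPoints.map (fiberι g s) x, s, hs, x, rfl⟩, (AlgPoints.mapContinuous (L := ℂ) (fiberι g s)).continuous.subtype_mk _⟩ : C(ComplexPoints (fiberOver g s), Tg V)) n').hom; AlgebraicGeometry.IsOpenImmersion j.left → Nat.card {p : ComplexPoints (projectiveSpace 1 ℂ) // p ∉ Set.range (AlgPoints.map j)} = 3 → (∀ t₀, ∃ V ∈ nhds t₀, ∃ (N : Submodule ℚ (singularCohomology ℚ ℚ (Tf V) n)) (N' : Submodule ℚ (singularCohomology ℚ ℚ (Tg V) n')) (Φ : N →ₗ[ℚ] N'), ∀ t (ht : t ∈ V), Submodule.map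 (resf V t ht) N = L t ∧ (∀ x ∈ N, resf V t ht x = 0 → x = 0) ∧ Submodule.map (resg V t ht) N' = L' t ∧ (∀ x ∈ N', resg V t ht x = 0 → x = 0) ∧ ∀ (x : N) (hx : resf V t ht x ∈ L t), (φ t ⟨resf V t ht x, hx⟩).1 = resg V t ht (Φ x)) → (∀ L₁ : ∀ t : ComplexPoints U, Submodule ℚ (bettiCohomology (fiberOver f t) n), (∀ t, L₁ t ≤ L t) → (∀ t₀, ∃ V ∈ nhds t₀, ∃ N : Submodule ℚ (singularCohomology ℚ ℚ (Tf V) n), ∀ t (ht : t ∈ V), Submodule.map (resf V t ht) N = L₁ t ∧ ∀ x ∈ N, resf V t ht x = 0 → x = 0) → (∀ t, L₁ t = ⊥) ∨ (∀ t, L₁ t = L t)) → (∃ F : ∀ t : ComplexPoints U, Finset (bettiCohomology (fiberOver f t) n), (∀ t, Submodule.span ℚ (↑(F t) : Set (bettiCohomology (fiberOver f t) n)) = L t) ∧ ∀ t₀, ∃ V ∈ nhds t₀, ∃ G : Finset (singularCohomology ℚ ℚ (Tf V) n), ∀ t (ht : t ∈ V), Finset.image (resf V t ht) G = F t ∧ Set.InjOn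 (resf V t ht) ↑G) → (∀ t, (∃ e : B.W.obj (fiberOver f t) n →ₗ[ℚ] B.W.obj (fiberOver f t) n, B.W.IsAlgebraicOperator n n e ∧ e ∘ₗ e = e ∧ LinearMap.range e = Submodule.map (B.isoObj (fiberOver f t) n).symm.toLinearMap (L t)) ∧ (∃ e' : B.W.obj (fiberOver g t) n' →ₗ[ℚ] B.W.obj (fiberOver g t) n', B.W.IsAlgebraicOperator n' n' e' ∧ e' ∘ₗ e' = e' ∧ LinearMap.range e' = Submodule.map (B.isoObj (fiberOver g t) n').symm.toLinearMap (L' t))) → (∃ (t₀ : ComplexPoints U) (c : ℤ) (T₀ : B.W.obj (fiberOver f t₀) n →ₗ[ℚ] B.W.obj (fiberOver g t₀) n'), (n' : ℤ) = (n : ℤ) + 2 * c ∧ (∀ p : ℤ, Submodule.map (T₀.baseChange ℂ) ((B.hodge (hf.isSmoothProjective t₀) n).F p) ≤ (B.hodge (hg.isSmoothProjective t₀) n').F (p + c)) ∧ ∀ x : L t₀, T₀ ((B.isoObj (fiberOver f t₀) n).symm x.1) = (B.isoObj (fiberOver g t₀) n').symm (φ t₀ x).1) → ∀ t, ∃ T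 : B.W.obj (fiberOver f t) n →ₗ[ℚ] B.W.obj (fiberOver g t) n', B.W.IsAlgebraicOperator n n' T ∧ ∀ x : L t, T ((B.isoObj (fiberOver f t) n).symm x.1) = (B.isoObj (fiberOver g t) n').symm (φ t x).1

/-- item stmt-HodgeConjecture-3339 · crux · rank 3 · closed · moot by None · by planner
why it might fail: Vacuous as typed (antecedent false) yet closable only via ¬KummerEndgame, needing a BettiHodgeData term (none). Honestly blocked: B.hodge lacks cup/Gysin fields to carry (iv) down the tower; the parabolic projector (killing Gysin images of the n-dim boundary) needs B(D)-type input, known dim≤2 only.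
sources: Katz1996, Dettweiler2008MC, DettweilerSabbah2013, Andre1996Motifs, Kleiman1968AlgebraicCycles, Patrikis2016KugaSatakeI
[crux] Katz's algorithm made of cycles (card engine U1 + bookkeeping U5): KummerEndgame →
HypergeometricComparison. Proof plan: L ⊗ ℂ = ⊕ conjugate hypergeometrics H(α;β) (Levelt:
pseudo-reflection at the distinguished puncture); Katz1996 Thm 5.2.1 / BeukersHeckman1989: a word
MC_{χ_m}∘…∘MC_{χ_1} applied to a Kummer sheaf gives H, ranks 1,2,…,r; realise each inverse step
MC_{χ̄_j} on BOTH families by the cyclic-cover family X^{(j)} → U (Katz1996 Ch. 8, Dettweiler2008MC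
§2.6: graph of the cover composed with the character projector Σ χ(ζ)⁻¹ζ_*, a relative algebraic
cycle with ℚ(χ)-coefficients) and the inversion MC_χ MC_χ̄ ≅ id(−1) by the locus {f = t} ≅ X_t × 𝔸¹
in X^{(j+1)}_t; check at each level that (i) irreducibility, (iii) algebraic cut-out (base-changed
relative idempotent ∘ character projector ∘ PARABOLIC projector) and (iv) Hodge twist
(DettweilerSabbah2013 Thm 1: Hodge numbers and twists under MC_χ) are inherited, so that the bottom
(finite monodromy: Galois orbit of Kummer characters over the same U) is an instance of
KummerEndgame; then compose the 2m correspondences upward (Kleiman: composites/transposes of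
algebraic operators are algebraic — in-tree CorrespondencesComp -/
@[route_item "route-HodgeConjecture-KatzUnwinding"]
def UnwindingReduction : Prop :=
  KummerEndgame → HypergeometricComparison

-- item stmt-HodgeConjecture-3389 · crux · rank 4 · closed · moot by None · by planner — informal only, no Lean statement yet:
--   [crux] DELSARTE TOWER ENDGAME (card U2; the unconditionally closable sector of KummerEndgame). For
--   inputs f = an invertible / generalized-Dwork pencil X_t : F_A(x) = t·∏x_i^{b_i} in Pⁿ⁺¹ (Katz2009
--   §1; DoranEtAl2018 §1.2) and g = a Katz hypergeometric curve family yᴺ = xᵃ(1−x)ᵇ(1−tx)ᶜ (or another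
--   invertible pencil with the same hypergeometric constituent), every level X^{(j)} → U of the
--   unwinding tower of UnwindingReduction, after base change to the Fermat/Kummer curve T trivialising
--   the bottom Kummer characters, has a total space birational to a DELSARTE COMPLETE INTERSECTION (the
--   pencil param

/-- item stmt-HodgeConjecture-3340 · support · rank 9 · closed · moot by None · by planner
sources: Kleiman1968AlgebraicCycles, ShiodaKatsura1979, VoisinHodgeI2002
[support] Glue for the Delsarte endgame (Fermat product ⇢ Delsarte quotient, ShiodaKatsura1979): the
B-relative Hodge conjecture descends along a surjective morphism π : X → Y of smooth projective
n-folds (β Hodge on Y ⇒ π^*β Hodge (B.pullback_hom) ⇒ algebraic ⇒ β = deg(π)⁻¹ π_*π^*β algebraic).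
Provable from the Weil-cohomology axioms plus ONE topological input not yet in the tree: π^* is
injective in top degree for a surjective generically finite map (degree in Betti cohomology, via the
naturality of B.iso); true for every datum B. [difficulty: M] -/
@[route_item "route-HodgeConjecture-KatzUnwinding"]
def DominantDescent : Prop :=
  open Literature.AlgebraicGeometry.Motives Literature.AlgebraicTopology.SingularHomology in ∀ (B : BettiHodgeData ℂ) (n : ℕ) (X Y : SchemeOver ℂ) (hX : IsSmoothProjective n X) (hY : IsSmoothProjective n Y) (π : X ⟶ Y), AlgebraicGeometry.Surjective π.left → (∀ p : ℕ, B.HodgeConjectureFor hX p) → ∀ p : ℕ, B.HodgeConjectureFor hY p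

-- item stmt-HodgeConjecture-3397 · support · rank 9 · closed · moot by None · by planner — informal only, no Lean statement yet:
--   [support] ONE-STEP CORRESPONDENCE CALCULUS ON THE LEGENDRE FAMILY (the refuter's decisive test for
--   UnwindingReduction; card U1 in its smallest instance; everything is curves and surfaces, so
--   Lefschetz (1,1) decides algebraicity and the item is provable-or-refutable NOW on paper). Let 𝓛 be
--   the rank-one local system on U = P¹∖{0,1,∞} with monodromy −1 at 0 and 1 (H⁰ of the double cover v²
--   = x(x−1), anti-invariant part), E_t : y² = x(x−1)(x−t) the Legendre curve, so H¹(E_t) =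
--   MC_{−1}(𝓛)(twist). (a) DOWN: the one-step unwinding of H¹(E/U) is carried by the elliptic surface
--   S_{t₁} : y² = x(x−1)(x −

-- item stmt-HodgeConjecture-3421 · support · rank 9 · closed · moot by None · by planner — informal only, no Lean statement yet:
--   [support] HODGE/TWIST BOOKKEEPING DOWN THE TOWER (card U5; the lemma that makes the Hodge hypothesis
--   (iv) of KummerEndgame available at the bottom of UnwindingReduction). For a ℚ-irreducible
--   hypergeometric-type constituent L ⊂ Rⁿf_*ℚ and L' ⊂ R^{n'}g_*ℚ with a flat iso φ that is Hodge up to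
--   the Tate twist c = (n'−n)/2 at one point, and for each step of Katz's inverse word (twist by a
--   rank-one Kummer sheaf, then MC_{χ̄}), the induced flat iso φ^{(j)} : L^{(j)} → L'^{(j)} between the
--   level-j constituents (inside H^{n+j} resp. H^{n'+j} of the fibres of the level-j cover families) is
--   again Hodge u

-- item stmt-HodgeConjecture-3444 · support · rank 9 · closed · moot by None · by planner — informal only, no Lean statement yet:
--   [support] CENSUS OF HYPERGEOMETRIC COMPARISON PAIRS (card U4; decides Kill criterion (c) and
--   supplies the instances of HypergeometricComparison worth proving or refuting). Produce, with sources
--   and computed local monodromies/Hodge types, the list of pairs (f, g, L ≅ L') of smooth projective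
--   families over a thrice-punctured P¹ sharing an irreducible hypergeometric constituent, classified
--   as: (A) already related by a dominant rational map / explicit correspondence (Shioda maps between
--   Doran–Greene–Judes symmetric quintic pencils and the Dwork/mirror quintic: BiniVangeemenKelly2011;
--   BHK mirrors v

/-- item stmt-HodgeConjecture-3341 · assembly · rank 1 · closed · moot by None · by planner
sources: Katz1996
[assembly] UnwindingReduction → KummerEndgame → HypergeometricComparison (modus ponens; calibration
item). -/
@[route_item "route-HodgeConjecture-KatzUnwinding"]
def Assembly : Prop :=
  UnwindingReduction → KummerEndgame → HypergeometricComparison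

end Summit.HodgeConjecture.HodgeConjecture.Theses.KatzUnwinding
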